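import Summits.AnomalousDissipation.AnomalousDissipation.Theorems.DenseLoudDesignerForces.Negative.KillShape
import Summits.AnomalousDissipation.AnomalousDissipation.Theorems.DenseLoudDesignerForces.Negative.PowerBudget
import Literature.Analysis.FluidPDE.LinearizedNSTorus
import Literature.Analysis.FluidPDE.LongTimeAveragePeriodic
import HarnessLib.Audit

/-!
# Line `homoclinic-excursion-trains` — skeleton for crux `BaireTransfer.DenseLoudDesignerForces`
(item stmt-AnomalousDissipation-1143, route route-AnomalousDissipation-BaireTransfer; crux-plan round 2, gen 2)

Crux (FIXED; `crux_iff` below is `Iff.rfl` over the landed vocabulary `Negative.loudSet` / `Negative.force` of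
`Theorems/DenseLoudDesignerForces/Negative/KillShape.lean`):
`∀ S₀ ∃ S ⊇ S₀ ∃ E ε, 0 < ε ∧ ∃ U ⊆ P_S open ≠ ∅, ∀ j, U ⊆ closure LOUD_j(S,E,ε)`, where `c ∈ LOUD_j` iff the steady
trigonometric-polynomial designer force `f_c` carries, at SOME `ν ∈ (0, 1/(j+1))`, a time-periodic classical NS
solution on `ℝ × T³` with mean energy `≤ E` and mean dissipation `≥ ε`.

Idea (crux idea card `Ideas/homoclinic-excursion-trains.md`, ideator 6; triage r2-1 pass, r2-2 fail, r2-3 pass):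
MANUFACTURE the loud periodic witnesses at FIXED `(c, ν)` from two finite objects of the `ν > 0` dynamics — a
HYPERBOLIC, genuinely time-periodic orbit `P` (ANY budget: calm, loud or fat) and ONE TRANSVERSE HOMOCLINIC ORBIT `Γ`
of `P` whose excursion is a long loud transient — by the Smale–Birkhoff / shadowing theorem for semiflows and `C¹`
maps in Banach space (HaleLin1986 Thm. 5.2 + §8, SteinleinWalther1990, Chow–Lin–Palmer 1989): one-loop periodic
orbits ("trains") shadow the excursion and inherit its window budgets, the dwell near `P` being weighted by the
DUTY DEFECT.  The crux's distinctive resource — forces RE-CHOSEN per level, DENSITY instead of membership — is used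
verbatim: the physics stub asks for the `(P, Γ)` structure at SOME small `ν` for a DENSE set of `c` at each level
(triage r2-1/2/3: the card's Transfer `H_ex` with ONE ball at ALL levels overshot into CoherentThesis 0218; the
per-level density form `H_ex′` is what is filed, and no force-openness / `ν`-uniform radius is claimed anywhere, so
r2-2's lift-up persistence-radius objection is moot).

## Architecture: ENGINE + BUDGET + PHYSICS, glued through an intrinsic CLOSING TIME (gen 2: two-sided duty)

* `stub_oneLoopTrains` (ENGINE, fixed-`ν` smooth dynamics, size XL; unchanged from gen 1): an equation-level
  HYPERBOLIC periodic orbit (`IsHyperbolicOrbit`: in-slice Floquet–Bloch form — no unimodular multiplier except the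
  algebraically simple `1`) plus an equation-level TRANSVERSE homoclinic orbit (`IsHomoclinicTo` + `IsTransverse`:
  Palmer's dichotomy form — the only `H¹`-bounded solutions on `ℝ` of the linearised equation along `Γ` are the
  multiples of `∂ₜu_Γ`) give, for every cut length `ℓ ≥ 0` and accuracy `δ > 0`, a ONE-LOOP TRAIN: a periodic
  classical solution of the SAME forced system, period `ℓ + d` for some dwell `d ≥ 0`, `δ`-close to `u_Γ(t)` in
  `H¹` for `t ∈ [-d/2, ℓ + d/2]` (`IsTrain`).
* `stub_trainBudget` (BUDGET, torus calculus, size M — the card's `burst_floor` AND its energy twin, both with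
  their duty factors): a train of an excursion with window floor `ν∫₀^ℓ‖∇u_Γ‖² ≥ εₓℓ`, WINDOW-MEAN energy
  `∫₀^ℓ‖u_Γ(t)‖₂² dt ≤ Ēℓ` and loop-wide sup bounds `‖u_Γ(t)‖₂² ≤ P̄`, `‖∇u_Γ(t)‖₂² ≤ Ḡ` (all `t`) has
  `meanDissipation ≥ (εₓ − 2νδ√Ḡ)·ℓ/(ℓ+d)` and `meanEnergy ≤ 2Ē + 2δ² + 2P̄·d/(ℓ+d)`.
* `stub_denseLoudLoops` (PHYSICS = the sharpened Transfer `H_ex′`, HARDEST): `∀ S₀ ∃ S ⊇ S₀ ∃ εₓ > 0, Ē,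
  ∃ U open ≠ ∅, ∀ j, U ⊆ closure LOOP_j`, where `c ∈ LOOP_j(S,εₓ,Ē)` (`loopSet`) iff at SOME `ν ∈ (0,1/(j+1))`
  the force `f_c` carries a hyperbolic–transverse homoclinic loop with a loud excursion window `[0, ℓ]` of
  window-mean energy `≤ Ē`, SOME loop-wide bounds `P̄` (energy — the base's FATNESS) and `Ḡ` (gradient) —
  both LEVEL-DEPENDENT: a loud window forces `Ḡ ≥ εₓ/ν`, and a calm or fat base near the laminar sheet has
  `P̄ ≍ ν⁻²`; neither enters the crux budgets — an AFFORDABLE accuracy `δ` (`δ ≤ 1`, `4νδ√Ḡ ≤ εₓ`: only COARSE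
  shadowing, a fixed fraction of the excursion's own `H¹` size, is ever needed) and the FATNESS-WEIGHTED
  closing-time clause `(1 + P̄)·trainDwell ≤ ℓ`, `trainDwell` being the one-loop CLOSING TIME (the infimum of the
  dwells of `δ`-trains; junk value `0` when no train exists, so it carries NO existence claim — existence is the
  engine's job): "the loud transient outlasts the closing time TIMES the base's fatness".  This is triage r2-1
  (1b) — "T_dwell ≳ ν⁻¹log(1/δ), so T_ex must outgrow E_P·T_dwell (≈ ν⁻³ when E_P ≍ ν⁻²): the first thing a
  crux-plan stub must quantify" — QUANTIFIED rather than excluded (gen 1 had instead paid a fat base in a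
  `j`-uniform sup-energy bound, which silently removed the card's calm/fat-base regime and asked the excursion's
  INSTANTANEOUS energy to be bounded uniformly in `j`; gen 2 asks only what the crux asks — a MEAN energy — plus
  level-dependent sup bounds that are free for any eternal loop).

WHY THE CLOSING TIME IS A SEPARATE DATUM (planner's audit of the card, gen 1, kept): the dwell a train needs at
accuracy `δ` is `≍ λ⁻¹ log(L/δ)` with `λ` the slowest Floquet rate of `P` AND `L` the shadowing
(transversality/dichotomy) constant of `Γ`; `L` is not an equation-level quantity, so no split "qualitative engine
+ structural density" closes the budgets without naming the closing time (and a `∀`-loops dwell law is false,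
validity being upward closed in `ℓ`).  The skeleton therefore books it as the intrinsic number `trainDwell` and
leaves the quantitative shadowing law (`trainDwell ≤ A + B·log(1/δ)`, `B ≍ 1/λ`) as the foreseen second-layer
split of the physics stub (line card, "Two-layer plan").

Composition (`DenseLoudDesignerForces_of`, sorry-free): budgets `E := 2Ē + 6`, `ε := εₓ/6` (fixed before `U`
and `j`: they depend on `Ē`, `εₓ` only); for `c ∈ LOOP_j` the engine makes the dwell set non-empty, so
`(1 + P̄)·trainDwell ≤ ℓ` yields a train with `(1 + P̄)·d < 2ℓ` (`csInf_lt_iff`), i.e. `d < 2ℓ` (duty `> 1/3`) AND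
`P̄·d/(ℓ+d) < 2` (the fat dwell costs at most `4` in mean energy); the budget stub and `4νδ√Ḡ ≤ εₓ`, `δ ≤ 1` give
`meanDissipation ≥ (εₓ/2)(1/3)` and `meanEnergy ≤ 2Ē + 2 + 4`; hence `LOOP_j ⊆ LOUD_j(S,E,ε)`
(`loopSet_subset_loudSet`) and `closure_mono` finishes.

## Disproof.lean obligations honoured (cdisprove gen 2–3, `Cruxes/DenseLoudDesignerForces/Disproof.lean` v15, and the
landed `Theorems/DenseLoudDesignerForces/Negative/*.lean`, two of which are IMPORTED here)

* §7 `denseLoudDesignerForces_false_without_convection` (H = the convective term): honoured AT `stub_denseLoudLoops` —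
  the window floor `εₓℓ ≤ ν∫₀^ℓ‖∇u_Γ‖²` is asked of a LONG excursion (`ℓ ≥ (1+P̄)·trainDwell`) of bounded mean energy,
  which by the energy balance over the window (`ν∫₀^ℓ‖∇u_Γ‖² ≤ ‖f_c‖₂√(Ēℓ)·√ℓ + P̄/2 = ℓ‖f_c‖₂√Ē + P̄/2`) must be
  sustained by injected power once `ℓ ≫ P̄/εₓ`, i.e. by the Reynolds work of §8 (`reynoldsWork_ge`) along the
  excursion — never by the base `P`, never by a one-shot discharge of a fat base's energy (the admission condition
  NegativeNotesIdeator5 N-C / triage r2-3: charge–discharge witnesses are log-quiet; here a discharge can supply at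
  most `P̄/2` of the `εₓℓ` demanded).
* §9 `not_window_bandLimited`: honoured — excursions are not band-limited; nothing here is a finite-mode witness.
* §10 `mem_loudSet_iff_unit_viscosity` / A3: honoured — no level is reached by rescaling; `LOOP_j` asks for its own
  `(ν, P, Γ, P̄, Ḡ)` at every level and the budgets `(εₓ, Ē)` are fixed BEFORE `U` and `j`.
* §3/§4/§6 window bounds (`meanDissipation_sq_le`, `sq_le_gradBound_mul_sq_of_window`): automatic for the trains
  (they are genuine periodic orbits); the composition's `(E, ε) = (2Ē + 6, εₓ/6)` is budget-monotone.
* §12 planar-false, §13 Beltrami-false: honoured — the loop lives in `T³` and its excursion is genuinely nonlinear.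
* §17 period floor: compatible — train periods `ℓ + d` are long.
* Refuted strengthenings AtRest / Everywhere / SameStock (§4): `U` is the physics stub's; `0 ∉ closure LOUD_j` is
  consistent with `LOOP_j ⊆ LOUD_j` (a loop with a loud window forces `c ≠ 0` by the power budget).
* Landed Negative lemmas imported: `KillShape` (vocabulary, kill shape), `PowerBudget` (`meanDissipation_eq_period_mean`,
  `meanEnergy_eq_period_mean` — the tools of `stub_trainBudget`).  No stub is an instance of a refuted statement
  (`ledger negatives`: 13037, 2859, 2979, 2984 — certificate / energy-ceiling statements, unrelated).
-/

set_option linter.dupNamespace false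

noncomputable section

open scoped BigOperators Topology
open Filter Set Function TopologicalSpace MeasureTheory

namespace Summit.AnomalousDissipation.AnomalousDissipation.Cruxes.DenseLoudDesignerForces.HomoclinicExcursionTrains

open Literature.Analysis.FunctionSpaces Literature.Analysis.FunctionSpaces.Torus
open Literature.Analysis.FluidPDE
open Summit.AnomalousDissipation.AnomalousDissipation.Theses.BaireTransfer
open Summit.AnomalousDissipation.AnomalousDissipation.Theorems.DenseLoudDesignerForces.Negative

/-- The flat unit torus `T³`. -/
local notation "𝕋³" => UnitAddTorus (Fin 3)
/-- Real velocity values. -/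
local notation "ℝ³" => EuclideanSpace ℝ (Fin 3)
/-- Complex Fourier coefficients / complexified velocities. -/
local notation "ℂ³" => EuclideanSpace ℂ (Fin 3)

/-! ## §0 The crux's vocabulary (the landed `Negative.force`, `Negative.loudSet`) -/

/-- **The crux, restated** through the landed vocabulary (definitional, as `Negative.denseLoudDesignerForces_iff`
with `IsWindow` unfolded). [folklore] -/
theorem crux_iff :
    DenseLoudDesignerForces ↔
      ∀ S₀ : Finset (Fin 3 → ℤ), ∃ S : Finset (Fin 3 → ℤ), S₀ ⊆ S ∧ ∃ (E ε : ℝ), 0 < ε ∧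
        ∃ U : Set (↥S → ℂ³), IsOpen U ∧ U.Nonempty ∧ ∀ j : ℕ, U ⊆ closure (loudSet S E ε j) :=
  Iff.rfl

/-! ## §1 The linearised Navier–Stokes equation around a space–time field -/

/-- **The linearised Navier–Stokes equation around the space–time field `u`** (real form, inhomogeneity `g`):
`z, q` jointly smooth on `ℝ × T³`, `z(t)` divergence free and MEAN ZERO (in-slice linearisation: `f_c` is mean
zero, the velocity mean is conserved, and every dynamical notion below lives in the affine slice `{∫u = ∫u_P}` —
the three Galilean/momentum directions are thereby removed, cf. triage X2/F1 of the sibling crux), and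
`∂ₜz + (u·∇)z + (z·∇)u = νΔz − ∇q + g` pointwise (the classical variational equation of NS; Henry 1981, ConstantinFoias1988
Ch. 7 for the steady case = the tree's `Torus.linearizedNSOperator`). [folklore] -/
@[folklore] def LinNSAround (ν : ℝ) (u z : ℝ → 𝕋³ → ℝ³) (q : ℝ → 𝕋³ → ℝ) (g : ℝ → 𝕋³ → ℝ³) : Prop :=
  IsSmoothSpaceTimeOn Set.univ z ∧ IsSmoothSpaceTimeOn Set.univ q ∧
    (∀ t, IsDivFree (z t)) ∧ (∀ t, HasZeroMean (z t)) ∧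
    ∀ t x, Torus.timeDerivWithin Set.univ z t x + convect (u t) (z t) x + convect (z t) (u t) x =
      ν • laplacian (z t) x - Torus.gradient (q t) x + g t x

/-- The complexified homogeneous linearised equation around `u` (for Floquet–Bloch solutions with unimodular
multipliers `ρ ≠ 1`): `∂ₜz + DB(u(t)) z = νΔz − ∇q` with the tree's `Torus.linConvect (u t) (z t) = (u·∇)z + (z·∇)u`,
`z(t)` complex, divergence free, mean zero. [folklore] -/
@[folklore] def LinNSAroundC (ν : ℝ) (u : ℝ → 𝕋³ → ℝ³) (z : ℝ → 𝕋³ → ℂ³) (q : ℝ → 𝕋³ → ℂ) : Prop :=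
  IsSmoothSpaceTimeOn Set.univ z ∧ IsSmoothSpaceTimeOn Set.univ q ∧
    (∀ t, Torus.IsDivFreeC (z t)) ∧ (∀ t, HasZeroMean (z t)) ∧
    ∀ t x, Torus.timeDerivWithin Set.univ z t x + Torus.linConvect (u t) (z t) x =
      ν • laplacian (z t) x - Torus.gradientC (q t) x

/-- The flow direction `∂ₜu` (a solution of the homogeneous linearised equation around every classical solution
of the steadily forced system). [folklore] -/
@[folklore] def flowDir (u : ℝ → 𝕋³ → ℝ³) : ℝ → 𝕋³ → ℝ³ :=
  fun t x => Torus.timeDerivWithin Set.univ u t x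

/-! ## §2 Hyperbolic periodic orbits (equation-level Floquet form) -/

/-- **Hyperbolicity of a `τ`-periodic classical solution `u` of NS_ν (in its mean slice)**, stated WITHOUT a
period map, through Floquet–Bloch solutions of the linearised equation: (a) for every UNIMODULAR multiplier
`ρ ≠ 1` the complex linearised equation has no non-zero Bloch solution `z(t+τ) = ρ z(t)`; (b) the multiplier `1`
is algebraically simple with eigenvector the flow direction — every smooth mean-zero `τ`-periodic solution `z` of
`∂ₜz + (u·∇)z + (z·∇)u = νΔz − ∇q + κ∂ₜu` has `κ∂ₜu ≡ 0` and `z ∈ ℝ∂ₜu` (no second eigenvector, no Jordan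
partner).  At `ν > 0` the in-slice period map `U(τ)` is compact, its Floquet multipliers are eigenvalues, and Bloch
solutions on `ℝ` are exactly eigenvectors (continue `U(t)v` backwards along `ρ^{-k}`), so (a)+(b) say: the
Poincaré return map at `u(0)` has a HYPERBOLIC fixed point (HaleLin1986 Def. 8.1: `σ(DF(ξ(0))) ∩ {|λ| = 1} = ∅` for the
return map `F`, independent of the section, Thm. 8.3). [cite: HaleLin1986, Def. 8.1] -/
@[folklore] def IsHyperbolicOrbit (ν : ℝ) (u : ℝ → 𝕋³ → ℝ³) (τ : ℝ) : Prop :=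
  (∀ (z : ℝ → 𝕋³ → ℂ³) (q : ℝ → 𝕋³ → ℂ) (ρ : ℂ), ‖ρ‖ = 1 → ρ ≠ 1 →
      LinNSAroundC ν u z q → (∀ t x, z (t + τ) x = ρ • z t x) → ∀ t x, z t x = 0) ∧
  (∀ (z : ℝ → 𝕋³ → ℝ³) (q : ℝ → 𝕋³ → ℝ) (κ : ℝ),
      LinNSAround ν u z q (fun t x => κ • flowDir u t x) → Function.Periodic z τ →
        (∀ t x, κ • flowDir u t x = 0) ∧ ∃ l : ℝ, ∀ t x, z t x = l • flowDir u t x)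

/-! ## §3 Homoclinic excursions and their transversality (equation level) -/

/-- Squared `H¹` distance of two velocity fields: `∫‖v − w‖² + ‖∇(v − w)‖₂²` (pointwise gradients,
`Torus.gradNormSq`; meaningful for `C¹` fields, which is how it is used). [folklore] -/
@[folklore] def h1DistSq (v w : 𝕋³ → ℝ³) : ℝ :=
  (∫ x, ‖v x - w x‖ ^ 2) + gradNormSq (fun x => v x - w x)

/-- **`u_Γ` is homoclinic to the periodic orbit of `u_P`**: it is `H¹`-asymptotic, as `t → +∞` and as
`t → −∞`, to two time-shifted copies of `u_P` (the asymptotic phases `θ₊`, `θ₋` exist at a hyperbolic periodic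
orbit; HaleLin1986 Def. 8.2, Palmer1984 Prop. 2.2).  The trivial case `u_Γ = u_P` is allowed (then the excursion is the base
itself). [cite: HaleLin1986, Def. 8.2] -/
@[folklore] def IsHomoclinicTo (uP uΓ : ℝ → 𝕋³ → ℝ³) : Prop :=
  ∃ θp θm : ℝ, Tendsto (fun t => h1DistSq (uΓ t) (uP (t + θp))) atTop (𝓝 0) ∧
    Tendsto (fun t => h1DistSq (uΓ t) (uP (t + θm))) atBot (𝓝 0)

/-- **Transversality of the homoclinic orbit `u_Γ`, in PALMER'S DICHOTOMY FORM** (no invariant manifolds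
needed): every smooth mean-zero solution `z` of the homogeneous linearised equation around `u_Γ` that is defined on
all of `ℝ` and `H¹`-BOUNDED is a real multiple of the flow direction `∂ₜu_Γ`.  (Bounded-backward solutions span
`T W^{cu}(P)`, bounded-forward ones `T W^{cs}(P)`; with `P` hyperbolic and `W^u(P)` finite dimensional,
`dim(T W^u ∩ T W^s) = 1` iff `W^u(P) ⋔ W^s(P)` along `Γ` — Palmer1984 Prop. 2.2 (ii): transversal homoclinic point iff
convergence + exponential dichotomy of the variational equation on `(-∞, ∞)`, Lemma 4.2: then the bounded solutions are the
span of the flow direction; Lin1986 for semiflows of functional differential equations; HaleLin1986 Def. 8.2 for the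
geometric form at a periodic trajectory.) [cite: Palmer1984, Prop. 2.2 (ii) and Lemma 4.2] -/
@[folklore] def IsTransverse (ν : ℝ) (uΓ : ℝ → 𝕋³ → ℝ³) : Prop :=
  ∀ (z : ℝ → 𝕋³ → ℝ³) (q : ℝ → 𝕋³ → ℝ), LinNSAround ν uΓ z q (fun _ _ => 0) →
    (∃ M : ℝ, ∀ t, (∫ x, ‖z t x‖ ^ 2) + gradNormSq (z t) ≤ M) →
      ∃ l : ℝ, ∀ t x, z t x = l • flowDir uΓ t x

/-- **A hyperbolic–transverse homoclinic LOOP of NS_ν with steady force `F`**: a GENUINELY time-periodic (not steady: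
`∂ₜu_P ≢ 0`) `τ_P`-periodic classical solution `u_P` on `ℝ × T³` (the BASE — any budget: calm, loud or fat),
hyperbolic in its mean slice, and a classical solution `u_Γ` on `ℝ × T³` (the EXCURSION) homoclinic to it and
transverse.  Non-steadiness is load-bearing (the card's caveat (1a), triage r2-1): for a periodic base
`dim W^u(P) + codim W^s(P)` exceed the ambient dimension by one, so a transverse `Γ` is codimension ZERO and carries
a Smale–Birkhoff horseshoe, whereas a nondegenerate homoclinic orbit of a hyperbolic STEADY state is codimension one
(Shilnikov) and in the tame-saddle case has no periodic orbits nearby — there `IsTransverse` would still hold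
(`∂ₜu_Γ` spans the bounded solutions) but Stub 1 would be false.  Two finite objects of the fixed-`ν` dynamics, both
within reach of validated numerics at moderate `ν` (radii-polynomial periodic orbits BergBredenLessardVeen2021;
connecting orbits); at small `ν` they are the physics stub's hypothesis.  Pressures are existentially quantified so
that the closing time below depends on velocities only. [cite: HaleLin1986, Def. 8.1–8.2] -/
@[folklore] structure IsHomoclinicLoop (ν : ℝ) (F : 𝕋³ → ℝ³) (uP : ℝ → 𝕋³ → ℝ³) (τP : ℝ)
    (uΓ : ℝ → 𝕋³ → ℝ³) : Prop where
  /-- the base period is positive -/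
  period_pos : 0 < τP
  /-- the base is a global classical solution of NS_ν(F) -/
  base : ∃ pP : ℝ → 𝕋³ → ℝ, IsClassicalNSSolutionOn Set.univ ν (fun _ => F) uP pP
  /-- the base is `τ_P`-periodic … -/
  periodic : Function.Periodic uP τP
  /-- … and genuinely time dependent (not a steady state) -/
  nonsteady : ∃ (t : ℝ) (x : 𝕋³), flowDir uP t x ≠ 0
  /-- the base is hyperbolic in its mean slice -/
  hyperbolic : IsHyperbolicOrbit ν uP τP
  /-- the excursion is a global (eternal) classical solution of NS_ν(F) -/
  excursion : ∃ pΓ : ℝ → 𝕋³ → ℝ, IsClassicalNSSolutionOn Set.univ ν (fun _ => F) uΓ pΓ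
  /-- the excursion is homoclinic to the base -/
  homoclinic : IsHomoclinicTo uP uΓ
  /-- and transverse (Palmer form) -/
  transverse : IsTransverse ν uΓ

/-! ## §4 One-loop trains and the closing time of an excursion -/

/-- **A ONE-LOOP TRAIN of the excursion `u_Γ` (cut length `ℓ`, accuracy `δ`, dwell `d`)**: a periodic classical
solution `u` of the SAME system NS_ν(F) on `ℝ × T³`, period `ℓ + d`, which is `δ`-close to `u_Γ(t)` in `H¹` for
every `t` in ONE FULL PERIOD `[-d/2, ℓ + d/2]` — it follows the excursion window `[0, ℓ]` and the two adjacent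
tails of `Γ` (which run to and from the base), closing up inside the tails.  These are the simplest periodic points
of the Smale–Birkhoff horseshoe of `P ∪ Γ` (itinerary "one excursion, then `m` turns near `P`"; HaleLin1986 Thm. 5.2,
SteinleinWalther1990). [folklore] -/
@[folklore] def IsTrain (ν : ℝ) (F : 𝕋³ → ℝ³) (uΓ : ℝ → 𝕋³ → ℝ³) (ℓ δ d : ℝ) (u : ℝ → 𝕋³ → ℝ³)
    (p : ℝ → 𝕋³ → ℝ) : Prop :=
  IsClassicalNSSolutionOn Set.univ ν (fun _ => F) u p ∧ Function.Periodic u (ℓ + d) ∧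
    ∀ t ∈ Set.Icc (-(d / 2)) (ℓ + d / 2), h1DistSq (u t) (uΓ t) ≤ δ ^ 2

/-- The DWELL SET of the excursion at cut length `ℓ` and accuracy `δ`: the dwells `d ≥ 0` of its one-loop trains.
[folklore] -/
@[folklore] def dwellSet (ν : ℝ) (F : 𝕋³ → ℝ³) (uΓ : ℝ → 𝕋³ → ℝ³) (ℓ δ : ℝ) : Set ℝ :=
  {d | 0 ≤ d ∧ ∃ (u : ℝ → 𝕋³ → ℝ³) (p : ℝ → 𝕋³ → ℝ), IsTrain ν F uΓ ℓ δ d u p}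

/-- **The one-loop CLOSING TIME `trainDwell ν F u_Γ ℓ δ`**: the infimum of the dwells of `δ`-accurate one-loop
trains of the excursion.  JUNK VALUE `0` when no train exists (`Real.sInf_empty`) — deliberately: this number carries
NO existence claim, existence of trains being exactly the content of the engine stub `stub_oneLoopTrains`; the
physics stub only compares it with the excursion length.  Shadowing theory predicts
`trainDwell ≍ λ⁻¹·log(L/δ)` (`λ` = Floquet gap of the base, `L` = dichotomy constant of `Γ`). [folklore] -/
@[folklore] def trainDwell (ν : ℝ) (F : 𝕋³ → ℝ³) (uΓ : ℝ → 𝕋³ → ℝ³) (ℓ δ : ℝ) : ℝ :=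
  sInf (dwellSet ν F uΓ ℓ δ)

/-- The dwell set is bounded below by `0`. [folklore] -/
theorem dwellSet_bddBelow (ν : ℝ) (F : 𝕋³ → ℝ³) (uΓ : ℝ → 𝕋³ → ℝ³) (ℓ δ : ℝ) :
    BddBelow (dwellSet ν F uΓ ℓ δ) :=
  ⟨0, fun _ hd => hd.1⟩

/-! ## §5 The loop sets of the physics stub -/

/-- **`LOOP_j(S, εₓ, Ē)`** — coefficient vectors `c` whose force `f_c` carries, at SOME `ν ∈ (0, 1/(j+1))`, a
hyperbolic–transverse homoclinic loop `(u_P, τ_P, u_Γ)` with: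
* a LOUD EXCURSION WINDOW `[0, ℓ]`, `ℓ > 0`, `ν∫₀^ℓ ‖∇u_Γ‖² ≥ εₓℓ`, of BOUNDED WINDOW-MEAN ENERGY
  `∫₀^ℓ ‖u_Γ(t)‖₂² dt ≤ Ēℓ` — the two budgets `(εₓ, Ē)` are the only level-independent data;
* SOME loop-wide bounds, chosen PER LEVEL and never entering the budgets: the FATNESS `‖u_Γ(t)‖₂² ≤ P̄` for all
  `t` (Γ's tails converge to the base, so `P̄` also bounds the base orbit: a calm base has `P̄ ≍ Ē`, a fat base
  riding the laminar sheet has `P̄ ≍ ν⁻²` — ALLOWED, and paid for below in closing time, exactly the card's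
  duty-cycle bet) and the gradient bound `‖∇u_Γ(t)‖₂² ≤ Ḡ` for all `t` (a loud window forces `Ḡ ≥ εₓ/ν → ∞` along
  the levels; it enters only the affordability clause);
* an AFFORDABLE ACCURACY `δ` — `0 < δ ≤ 1` and `4νδ√Ḡ ≤ εₓ`, i.e. coarse: a fixed fraction of the excursion's own
  `H¹` size — at which the FATNESS-WEIGHTED one-loop closing time does not exceed the excursion length,
  `(1 + P̄) · trainDwell ν f_c u_Γ ℓ δ ≤ ℓ` ("the loud transient outlasts the time its trains need to close up
  near the base, times the base's fatness": duty `≥ 1/2` and fat-dwell energy `P̄·d/(ℓ+d) ≲ 1`; triage r2-1 (1b)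
  quantified — with `trainDwell ≍ λ⁻¹log(1/δ)` this reads `T_ex ≳ (1 + E_P)·λ⁻¹·log(1/δ)`).
The level enters through `ν < 1/(j+1)`: `(ν, P, Γ, ℓ, P̄, Ḡ, δ)` are re-chosen at every level and every force, the
budgets `(εₓ, Ē)` are not. [folklore] -/
@[folklore] def loopSet (S : Finset (Fin 3 → ℤ)) (εx Eb : ℝ) (j : ℕ) : Set (↥S → ℂ³) :=
  {c | ∃ ν : ℝ, 0 < ν ∧ ν < 1 / ((j : ℝ) + 1) ∧
    ∃ (uP : ℝ → 𝕋³ → ℝ³) (τP : ℝ) (uΓ : ℝ → 𝕋³ → ℝ³) (ℓ Pb Gb δ : ℝ),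
      IsHomoclinicLoop ν (force S c) uP τP uΓ ∧ 0 < ℓ ∧
      εx * ℓ ≤ ν * ∫ t in (0 : ℝ)..ℓ, gradNormSq (uΓ t) ∧
      (∫ t in (0 : ℝ)..ℓ, (∫ x, ‖uΓ t x‖ ^ 2)) ≤ Eb * ℓ ∧
      (∀ t, (∫ x, ‖uΓ t x‖ ^ 2) ≤ Pb) ∧ (∀ t, gradNormSq (uΓ t) ≤ Gb) ∧
      0 < δ ∧ δ ≤ 1 ∧ 4 * ν * δ * Real.sqrt Gb ≤ εx ∧
      (1 + Pb) * trainDwell ν (force S c) uΓ ℓ δ ≤ ℓ}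

/-! ## §6 The three stubs of the line -/

/-- **Stub 1 — ENGINE: one-loop trains exist (Smale–Birkhoff / shadowing for the NS_ν semiflow).**
At `ν > 0`, a hyperbolic–transverse homoclinic loop `(u_P, τ_P, u_Γ)` of NS_ν(F) admits, for every cut length
`ℓ ≥ 0` and every accuracy `δ > 0`, a one-loop train: a periodic classical solution of NS_ν(F) of period `ℓ + d`
(`d ≥ 0`) that is `δ`-close in `H¹` to `u_Γ(t)` for all `t ∈ [-d/2, ℓ + d/2]`.
Why plausible (proof route, three printed ingredients + one dictionary):
(i) SECTION MODEL — at fixed `ν > 0` the forced NS semiflow on the mean slice of `H¹_σ(T³)` is analytic with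
compact, injective time-`t` maps having injective derivative (parabolic smoothing; backward uniqueness); the
first-return map `Φ` of a codimension-one section through `u_P(0)` and the transit map along the excursion are
`C¹` (indeed `C^ω`) with `DΦ` uniformly continuous near the compact set `T := {p₀} ∪ {q_n}` of section points of
`P ∪ Γ` (Henry1981 Ch. 7–8; HaleLin1986 §8: Def. 8.1 hyperbolic periodic trajectory := `σ(DΦ(p₀)) ∩ S¹ = ∅`,
independent of the section, Thm. 8.3 local stable/unstable manifolds).  DICTIONARY: `IsHyperbolicOrbit` (no
unimodular Floquet–Bloch multiplier in the mean-zero slice except the algebraically simple `1`) ⇔ `p₀` is a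
hyperbolic fixed point of `Φ` (compact monodromy ⇒ Riesz–Schauder: Bloch solutions on `ℝ` = eigenvectors;
quotienting the flow direction = passing to the section); `IsTransverse` (Palmer form: the `H¹`-bounded solutions
on `ℝ` of the linearised equation along `Γ` are `ℝ∂ₜu_Γ`) ⇔ `{q_n}` is a TRANSVERSAL homoclinic trajectory of
`Φ` (HaleLin1986 Def. 8.2 "iff transverse on the section"; Palmer1984 Prop. 2.2(ii) + Lemma 4.2, Lin1986:
transversality ⇔ exponential dichotomy of the variational equation on `ℤ` ⇔ no non-trivial bounded solution).
(ii) HYPERBOLIC SET — a transversal homoclinic trajectory of a hyperbolic fixed point of a `C¹` map in a Banach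
space has hyperbolic closure `T` (SteinleinWalther1990, title theorem; Pilyugin1999 Def. 1.14 "Steinlein–Walther
hyperbolic set", which does not even need `DΦ`-invariant unstable spaces; HaleLin1986 Thm. 5.2 = symbolic
dynamics near `T` for `C^k` maps that need not be diffeomorphisms).
(iii) SHADOWING WITH UNIQUENESS near `T` for non-invertible `C¹` maps of Banach spaces (ChowLinPalmer1989 main
theorem = Pilyugin1999 §1.3.4 (1.89)–(1.90): every `d`-pseudo-orbit in `T` is `ε`-shadowed by a UNIQUE orbit;
Pilyugin1999 Thm. 1.3.1/1.3.4/1.3.5: the sequence-of-maps shadowing lemma with non-invertible linear parts).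
Apply (iii) to the ONE-LOOP periodic pseudo-orbit `(q_{-k₋-b}, …, q_{-k₋}, [excursion], q_{k₊}, …, q_{k₊+a})`
repeated periodically (its only jump, at the closing point, is `≲ e^{-λ·min(a,b)τ_P}`): uniqueness makes the
shadowing orbit periodic (shift by one period), i.e. a periodic point of the section dynamics = a periodic STRONG
solution, smooth by parabolic regularity ⇒ classical.  (iv) PHASE BOOKKEEPING (why the PARAMETRISED `u_Γ` is
shadowed over one full period, planner's check): anchor the train's clock at the departure crossing; along the
finite excursion closeness is continuity of the semiflow; along the `a + b` windings the return times of train and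
`Γ` differ by `≤ C₁·ε` per turn, so the accumulated phase drift is `≤ C₁ε(a+b) ≍ ε log(1/ε) → 0`; at the closing
point the two tails of `u_Γ` agree because the train's period `ℓ + d ≈ (a+b+1+k₊+k₋)τ_P + θ₋ − θ₊` satisfies the
phase-matching condition automatically; finally `a − b` is chosen to CENTRE the comparison window `[-d/2, ℓ+d/2]`
on the loop to within `τ_P` and `a + b` large for accuracy — both free, so every `ℓ ≥ 0`, `δ > 0` is served.
Why it might fail (as a formalisation): none of the fixed-`ν` infrastructure is in the tree (NS_ν semiflow as a
`C¹` compact map, classical ⇄ mild dictionary for the linearised equation, stable/unstable manifolds, shadowing in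
Banach space) — size XL; mathematically it is printed theory (foreseen split E1a/E1b/E2 in the line card).  The
degenerate loop `u_Γ = u_P` is harmless (`u_P` itself is a train, `zero_mem_dwellSet`).  NON-STEADY base required
(`IsHomoclinicLoop.nonsteady`): for a steady hyperbolic base a nondegenerate homoclinic orbit is codimension one
(Shilnikov) and `IsTransverse` would hold at a tame saddle with NO periodic orbits nearby.  Leans on:
`IsClassicalNSSolutionOn`, `LinearizedNSTorus` (`Torus.linConvect`, `Torus.gradientC`, `Torus.IsDivFreeC`),
`TorusClassicalNSUniqueness` (energy methods); UNPROVED in tree, to vendor as named facts: HaleLin1986 Thm. 5.2 +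
§8, SteinleinWalther1990 (paywalled, acq-05264), ChowLinPalmer1989 (paywalled, acq-05361), Pilyugin1999 Thm.
1.3.1/1.3.4 and §1.3.4 (held, read), Palmer1984 Prop. 2.2 / Lin1986, Henry1981 (acq-04093).
[cite: HaleLin1986, Thm. 5.2 and §8 (Def. 8.1–8.2, Thm. 8.3)] [cite: Pilyugin1999, Thm. 1.3.1, §1.3.4 (Chow–Lin–Palmer (1.89)–(1.90); Def. 1.14, Thm. 1.3.4)] -/
theorem stub_oneLoopTrains {ν : ℝ} {F : 𝕋³ → ℝ³} {uP : ℝ → 𝕋³ → ℝ³} {τP : ℝ} {uΓ : ℝ → 𝕋³ → ℝ³}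
    (hν : 0 < ν) (hloop : IsHomoclinicLoop ν F uP τP uΓ) {ℓ : ℝ} (hℓ : 0 ≤ ℓ) {δ : ℝ} (hδ : 0 < δ) :
    ∃ d : ℝ, 0 ≤ d ∧ ∃ (u : ℝ → 𝕋³ → ℝ³) (p : ℝ → 𝕋³ → ℝ), IsTrain ν F uΓ ℓ δ d u p := by
  sorry

/-- **Stub 2 — BUDGET of a train (the card's `burst_floor` and its energy twin, two-sided, both duty-weighted).**
Let `u` be a one-loop train (period `ℓ + d`, accuracy `δ`, `ℓ > 0`, `d ≥ 0`, `0 ≤ δ`) of a classical excursion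
`u_Γ` with window floor `εₓℓ ≤ ν∫₀^ℓ‖∇u_Γ(t)‖²dt`, window-mean energy `∫₀^ℓ‖u_Γ(t)‖₂²dt ≤ Ēℓ` and loop-wide bounds
`‖u_Γ(t)‖₂² ≤ P̄`, `‖∇u_Γ(t)‖₂² ≤ Ḡ` (all `t`).  Then
`meanDissipation ν u ≥ (εₓ − 2νδ√Ḡ)·ℓ/(ℓ + d)` and `meanEnergy u ≤ 2Ē + 2δ² + 2P̄·d/(ℓ + d)`.
Why plausible (it is true; size M, ~400 lines of torus calculus): period means of a periodic classical orbit are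
honest period averages (`Negative.meanDissipation_eq_period_mean`, `Negative.meanEnergy_eq_period_mean`), and by
periodicity the period may be taken to be `[-d/2, ℓ + d/2]` (`Function.Periodic.intervalIntegral_add_eq`); on that
period `h1DistSq (u t) (u_Γ t) ≤ δ²` gives, by Minkowski in `L²` for `∇(u − u_Γ)` and `u − u_Γ`,
`‖∇u(t)‖₂² ≥ ‖∇u_Γ(t)‖₂² − 2δ√Ḡ` (also when `‖∇u_Γ(t)‖₂ < δ`, since then the right side is `≤ 0`) and
`‖u(t)‖₂² ≤ 2‖u_Γ(t)‖₂² + 2δ²`; DISSIPATION: drop the (non-negative) dissipation of the dwell and integrate the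
first bound over the window `[0, ℓ]`; ENERGY: integrate the second bound over the window (`≤ 2Ēℓ + 2δ²ℓ`) and over
the two dwell half-intervals (total length `d`, `≤ (2P̄ + 2δ²)d`), divide by `ℓ + d` and use `Ē ≥ 0` (forced by
the window hypothesis, `ℓ > 0`).  The DUTY FACTORS `ℓ/(ℓ+d)` and `d/(ℓ+d)` are where the base's quietness and
fatness are booked.  Interval integrability of `t ↦ ‖u(t)‖₂², ‖∇u(t)‖₂²` for jointly smooth fields:
`IsSmoothSpaceTimeOn.continuousOn_integral`-type lemmas (TorusCalculus).  Leans on: `meanDissipation_eq_period_mean`,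
`meanEnergy_eq_period_mean` (Negative/PowerBudget), `gradNormSq`, `gradNormSq_nonneg`, Mathlib
`intervalIntegral.integral_mono_on`, `MeasureTheory.Lp` triangle inequality (`eLpNorm_sub_le` / `L2` Minkowski).
[folklore] -/
theorem stub_trainBudget {ν ℓ δ d εx Eb Pb Gb : ℝ} {F : 𝕋³ → ℝ³} {uΓ u : ℝ → 𝕋³ → ℝ³} {pΓ p : ℝ → 𝕋³ → ℝ}
    (hν : 0 ≤ ν) (hℓ : 0 < ℓ) (hd : 0 ≤ d) (hδ : 0 ≤ δ)
    (hΓ : IsClassicalNSSolutionOn Set.univ ν (fun _ => F) uΓ pΓ) (htrain : IsTrain ν F uΓ ℓ δ d u p)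
    (hwin : εx * ℓ ≤ ν * ∫ t in (0 : ℝ)..ℓ, gradNormSq (uΓ t))
    (hwinE : (∫ t in (0 : ℝ)..ℓ, (∫ x, ‖uΓ t x‖ ^ 2)) ≤ Eb * ℓ)
    (hP : ∀ t, (∫ x, ‖uΓ t x‖ ^ 2) ≤ Pb) (hG : ∀ t, gradNormSq (uΓ t) ≤ Gb) :
    (εx - 2 * ν * δ * Real.sqrt Gb) * (ℓ / (ℓ + d)) ≤ meanDissipation ν u ∧
      meanEnergy u ≤ 2 * Eb + 2 * δ ^ 2 + 2 * Pb * (d / (ℓ + d)) := by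
  sorry

/-- **Stub 3 — PHYSICS (the sharpened Transfer `H_ex′`; HARDEST): loud, duty-dominated homoclinic loops are
dense per level.**  For every finite stock `S₀` there are `S ⊇ S₀`, an excursion loudness `εₓ > 0`, a window-mean
energy bound `Ē` and a non-empty open `U ⊆ P_S` such that at EVERY level `j` the set `LOOP_j(S, εₓ, Ē)` (`loopSet`:
at some `ν < 1/(j+1)`, `f_c` carries a hyperbolic–transverse homoclinic loop with a loud excursion window of length
`ℓ` and window-mean energy `≤ Ē`, SOME loop-wide fatness/gradient bounds `P̄, Ḡ`, and fatness-weighted closing time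
`(1 + P̄)·trainDwell ≤ ℓ` at an affordable accuracy `δ ≤ 1`, `4νδ√Ḡ ≤ εₓ`) is DENSE in `U`.
WHERE THE CRUX'S ONE RELAXATION ENTERS: here and only here — `(ν, P, Γ, ℓ, P̄, Ḡ, δ)` are chosen after `c` and
`j`, and only DENSITY of such `c` in `U` is asked (never membership of a fixed `c`, never a fixed ball at all
levels, never force-openness or a `ν`-uniform radius).
Why plausible: the documented structure of steadily forced 3-D box flows at and beyond onset — subcritical
transition, edge states, hyperbolic (relative) periodic orbits and homoclinic tangles (VanveenKawahara2011: tangle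
of an edge periodic orbit in shear flow; VeenGoto2016: subcritical 3-D Kolmogorov flow; KawaharaUhlmannVanveen2012
§4–5) — with turbulent-transient lifetimes growing super-exponentially in `1/ν` while the closing time grows like
the inverse slowest Floquet rate times a logarithm (`≲ ν⁻¹log` for a calm or fat base whose slowest stable rate is
viscous, faster under advection-enhanced relaxation) and the fatness like `ν⁻²` at worst — so
`(1 + P̄)·trainDwell ≲ ν⁻³log ≪ ℓ` with enormous room once `ν` is small IF the excursion is a metastable turbulent
episode; deep in the turbulent regime the same clause is met by O(1)-energy bases embedded in the turbulent set
(`P̄ ≍ Ē`, `Γ` = a long generic turbulent segment returning to an embedded UPO — the Smale–Birkhoff form of closing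
typical recurrences, cf. the sibling line `ergodic-budget-selection-closing`); hyperbolicity and transversality
are generic where the tangle exists at all, and density (not openness) in `c` is all that is asked, with
`(ν, P, Γ)` re-chosen per level (the crux's own resource).
Why it might FAIL (named, measurable modes, triage r2-1/r2-2/r2-3): (1b) DWELL BLOW-UP — bases available at
small `ν` are weakly hyperbolic (`λ_slow → 0`) or fat, or the transversality constant `L` degenerates, faster than
`ℓ(ν)` grows, so `(1 + P̄)·trainDwell > ℓ` at every affordable `δ` (the one computed NS tangle, VanveenKawahara2011
at `Re = 400`, has SHORT bursts — r2-2); (1c) NO RETURN — at small `ν` turbulence is an attractor disjoint from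
`W^s` of every hyperbolic periodic orbit outside it (sustained, never relaminarising), so loud `Γ` exist only for
bases INSIDE the turbulent set and the line adds to plain UPO closing only the freedom of a long excursion; and in
all regimes the loudness of the excursion is the zeroth law in transient form (`εₓℓ ≤ ℓ‖f_c‖₂√Ē + P̄/2` by the
window energy balance) — NOT evaded, only moved from exact periodic orbits to ONE finite-window transient plus two
finite hyperbolic objects.  Size: open (the bet).  Leans on: `loopSet` and everything above; Disproof §8
`reynoldsWork_ge` (what the excursion must do), §10 (no free level).  Cheapest falsifier (kit, for the lead):
Galerkin 3-D Kolmogorov flow `|k|∞ ≤ 4` with a small generic trig-poly perturbation of the force, at the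
VeenGoto2016 transition `ν`: edge-track to a periodic edge orbit `P`, shoot `W^u(P)`, detect return (`Γ`), measure
`ℓ`, `P̄` and the one-loop closing time by Newton–Krylov on the train; repeat at `ν/2`, `ν/4` — a FALLING
`ℓ/((1+P̄)·trainDwell)` kills the line for that force family. [cite: VanveenKawahara2011, abstract and §Homoclinic orbit computation (arXiv:1103.1331)] -/
theorem stub_denseLoudLoops :
    ∀ S₀ : Finset (Fin 3 → ℤ), ∃ S : Finset (Fin 3 → ℤ), S₀ ⊆ S ∧
      ∃ (εx Eb : ℝ), 0 < εx ∧
        ∃ U : Set (↥S → ℂ³), IsOpen U ∧ U.Nonempty ∧ ∀ j : ℕ, U ⊆ closure (loopSet S εx Eb j) := by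
  sorry

/-! ## §7 Glue (sorry-free) and the composition -/

/-- The fatness bound of a loop is non-negative (it bounds a squared `L²` norm). [folklore] -/
theorem fatness_nonneg {uΓ : ℝ → 𝕋³ → ℝ³} {Pb : ℝ} (hP : ∀ t, (∫ x, ‖uΓ t x‖ ^ 2) ≤ Pb) : 0 ≤ Pb :=
  (integral_nonneg fun _ => sq_nonneg _).trans (hP 0)

/-- **From closing time to an actual short train.**  For a genuine loop at `ν > 0` the engine makes the dwell set
non-empty, so the fatness-weighted clause `(1 + P̄)·trainDwell ≤ ℓ` (with `ℓ > 0`, `P̄ ≥ 0`) produces a train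
with `(1 + P̄)·d < 2ℓ` — i.e. dwell `d < 2ℓ` (duty `ℓ/(ℓ+d) > 1/3`) AND fat-dwell weight `P̄·d < 2ℓ`.  This is the
ONLY place the engine stub is used — and it is indispensable there (`trainDwell` of an empty dwell set is the junk
value `0`). [folklore] -/
theorem exists_short_train {ν : ℝ} {F : 𝕋³ → ℝ³} {uP : ℝ → 𝕋³ → ℝ³} {τP : ℝ} {uΓ : ℝ → 𝕋³ → ℝ³}
    (hν : 0 < ν) (hloop : IsHomoclinicLoop ν F uP τP uΓ) {ℓ δ Pb : ℝ} (hℓ : 0 < ℓ) (hδ : 0 < δ)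
    (hPb : 0 ≤ Pb) (hdw : (1 + Pb) * trainDwell ν F uΓ ℓ δ ≤ ℓ) :
    ∃ d : ℝ, 0 ≤ d ∧ (1 + Pb) * d < 2 * ℓ ∧
      ∃ (u : ℝ → 𝕋³ → ℝ³) (p : ℝ → 𝕋³ → ℝ), IsTrain ν F uΓ ℓ δ d u p := by
  have hne : (dwellSet ν F uΓ ℓ δ).Nonempty := by
    obtain ⟨d, hd, u, p, h⟩ := stub_oneLoopTrains hν hloop hℓ.le hδ
    exact ⟨d, hd, u, p, h⟩
  have h1 : 0 < 1 + Pb := by linarith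
  have hlt : sInf (dwellSet ν F uΓ ℓ δ) < 2 * ℓ / (1 + Pb) := by
    rw [lt_div_iff₀ h1]
    calc sInf (dwellSet ν F uΓ ℓ δ) * (1 + Pb) = (1 + Pb) * trainDwell ν F uΓ ℓ δ := by
          unfold trainDwell; ring
      _ ≤ ℓ := hdw
      _ < 2 * ℓ := by linarith
  obtain ⟨d, hd, hd2⟩ := (csInf_lt_iff (dwellSet_bddBelow ν F uΓ ℓ δ) hne).1 hlt
  refine ⟨d, hd.1, ?_, hd.2⟩
  rw [lt_div_iff₀ h1] at hd2
  linarith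

/-- **`LOOP_j ⊆ LOUD_j`** with the budgets `E := 2Ē + 6`, `ε := εₓ/6`: a short train of a loud excursion of
bounded window-mean energy is a loud bounded periodic witness of the SAME force at the SAME viscosity (Stubs 1 and
2; the affordable accuracy gives `εₓ − 2νδ√Ḡ ≥ εₓ/2`, the short dwell gives duty `> 1/3`, the fatness-weighted
clause gives `2P̄·d/(ℓ+d) < 4`, and `δ ≤ 1` caps the accuracy slack). [folklore] -/
theorem loopSet_subset_loudSet (S : Finset (Fin 3 → ℤ)) {εx : ℝ} (Eb : ℝ) (hεx : 0 < εx) (j : ℕ) :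
    loopSet S εx Eb j ⊆ loudSet S (2 * Eb + 6) (εx / 6) j := by
  rintro c ⟨ν, hν, hνj, uP, τP, uΓ, ℓ, Pb, Gb, δ, hloop, hℓ, hwin, hwinE, hP, hG, hδ, hδ1, hcoarse, hdw⟩
  have hPb : 0 ≤ Pb := fatness_nonneg hP
  obtain ⟨d, hd, hd2, u, p, htrain⟩ := exists_short_train hν hloop hℓ hδ hPb hdw
  obtain ⟨pΓ, hΓ⟩ := hloop.excursion
  obtain ⟨hdiss, hen⟩ := stub_trainBudget hν.le hℓ hd hδ.le hΓ htrain hwin hwinE hP hG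
  have hτ : 0 < ℓ + d := by linarith
  have hd2' : d < 2 * ℓ := by nlinarith
  refine ⟨ν, hν, hνj, ℓ + d, u, p, hτ, htrain.1, htrain.2.1, ?_, ?_⟩
  · -- energy: `2Ē + 2δ² + 2P̄·d/(ℓ+d) ≤ 2Ē + 2 + 4`
    have hfrac : 2 * Pb * (d / (ℓ + d)) ≤ 4 := by
      rw [show 2 * Pb * (d / (ℓ + d)) = 2 * Pb * d / (ℓ + d) by ring, div_le_iff₀ hτ]
      nlinarith
    have h2 : δ ^ 2 ≤ 1 := by nlinarith
    linarith
  · -- dissipation: `(εₓ − 2νδ√Ḡ) · ℓ/(ℓ+d) ≥ (εₓ/2) · (1/3)`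
    have ha : εx / 2 ≤ εx - 2 * ν * δ * Real.sqrt Gb := by linarith
    have hb : (1 : ℝ) / 3 ≤ ℓ / (ℓ + d) := by
      rw [le_div_iff₀ hτ]
      linarith
    have hprod : εx / 2 * (1 / 3) ≤ (εx - 2 * ν * δ * Real.sqrt Gb) * (ℓ / (ℓ + d)) :=
      mul_le_mul ha hb (by norm_num) (by linarith)
    calc εx / 6 = εx / 2 * (1 / 3) := by ring
      _ ≤ (εx - 2 * ν * δ * Real.sqrt Gb) * (ℓ / (ℓ + d)) := hprod
      _ ≤ meanDissipation ν u := hdiss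

/-! ### Entry 2 (sorry-free): a loud hyperbolic periodic orbit is the degenerate loop `Γ = P`

The hypothesis class of the line CONTAINS the direct witnesses of the sibling entry points (a loud, bounded,
hyperbolic, genuinely periodic orbit: the output of the closing card `ergodic-budget-selection-closing`, the
certified-UPO entry of `RobustLoudSomewhere` stmt-1150, triage r2-2's "salvage"): with `u_Γ := u_P`, the cut
`ℓ := τ_P` and the fatness `P̄ := sup_t ‖u_P(t)‖₂²`, the orbit is its own train with dwell `0`, so
`(1 + P̄)·trainDwell ≤ 0 ≤ ℓ` and the loud window is one period.  `LOOP_j` thus interpolates between "loud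
hyperbolic UPO" (no excursion) and "calm or fat base + long loud excursion". -/

/-- `‖∇0‖₂² = 0` (pointwise gradients of the zero field vanish). [folklore] -/
theorem gradNormSq_zero_fun : gradNormSq (fun _ : 𝕋³ => (0 : ℝ³)) = 0 := by
  unfold gradNormSq
  have hpd : ∀ (i : Fin 3) (x : 𝕋³), Torus.partialDeriv i (fun _ : 𝕋³ => (0 : ℝ³)) x = 0 := fun i x => by
    change deriv (fun _ : ℝ => (0 : ℝ³)) 0 = 0
    simp
  simp [hpd]

/-- `h1DistSq v v = 0`. [folklore] -/
theorem h1DistSq_self (v : 𝕋³ → ℝ³) : h1DistSq v v = 0 := by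
  unfold h1DistSq
  simp only [sub_self, norm_zero, ne_eq, OfNat.ofNat_ne_zero, not_false_eq_true, zero_pow, integral_zero,
    zero_add]
  exact gradNormSq_zero_fun

/-- Every space–time field is (trivially) homoclinic to itself. [folklore] -/
theorem isHomoclinicTo_self (u : ℝ → 𝕋³ → ℝ³) : IsHomoclinicTo u u := by
  refine ⟨0, 0, ?_, ?_⟩ <;> simpa only [add_zero, h1DistSq_self] using tendsto_const_nhds

/-- A `τ`-periodic classical solution is a one-loop train OF ITSELF with cut `τ` and dwell `0` (any accuracy).
[folklore] -/
theorem zero_mem_dwellSet {ν τ δ : ℝ} {F : 𝕋³ → ℝ³} {u : ℝ → 𝕋³ → ℝ³} {p : ℝ → 𝕋³ → ℝ}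
    (hsol : IsClassicalNSSolutionOn Set.univ ν (fun _ => F) u p) (hper : Function.Periodic u τ) :
    (0 : ℝ) ∈ dwellSet ν F u τ δ := by
  refine ⟨le_rfl, u, p, hsol, by simpa only [add_zero] using hper, fun t _ => ?_⟩
  rw [h1DistSq_self]
  positivity

/-- **Entry 2.** A force carrying, at `ν ∈ (0, 1/(j+1))`, a genuinely time-periodic, hyperbolic classical
solution `u` with a loud period (`εₓτ ≤ ν∫₀^τ‖∇u‖²`), period-mean energy `≤ Ē` (`∫₀^τ‖u‖₂² ≤ Ēτ`), sup bounds
`(P̄, Ḡ)` and an affordable accuracy lies in `LOOP_j` — the degenerate loop `u_Γ = u_P`, closing time `≤ 0`.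
(`IsTransverse ν u` for the base itself is a CONSEQUENCE of hyperbolicity — the bounded solutions around a
hyperbolic periodic orbit are the flow direction — but not definitionally, so it is kept as a hypothesis.)
[folklore] -/
theorem mem_loopSet_of_loudHyperbolicOrbit {S : Finset (Fin 3 → ℤ)} {εx Eb Pb Gb : ℝ} {j : ℕ} {c : ↥S → ℂ³}
    {ν τ δ : ℝ} {u : ℝ → 𝕋³ → ℝ³} {p : ℝ → 𝕋³ → ℝ}
    (hν : 0 < ν) (hνj : ν < 1 / ((j : ℝ) + 1)) (hτ : 0 < τ)
    (hsol : IsClassicalNSSolutionOn Set.univ ν (fun _ => force S c) u p) (hper : Function.Periodic u τ)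
    (hns : ∃ (t : ℝ) (x : 𝕋³), flowDir u t x ≠ 0) (hhyp : IsHyperbolicOrbit ν u τ) (htr : IsTransverse ν u)
    (hwin : εx * τ ≤ ν * ∫ t in (0 : ℝ)..τ, gradNormSq (u t))
    (hwinE : (∫ t in (0 : ℝ)..τ, (∫ x, ‖u t x‖ ^ 2)) ≤ Eb * τ)
    (hP : ∀ t, (∫ x, ‖u t x‖ ^ 2) ≤ Pb) (hG : ∀ t, gradNormSq (u t) ≤ Gb)
    (hδ : 0 < δ) (hδ1 : δ ≤ 1) (hco : 4 * ν * δ * Real.sqrt Gb ≤ εx) :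
    c ∈ loopSet S εx Eb j := by
  refine ⟨ν, hν, hνj, u, τ, u, τ, Pb, Gb, δ,
    ⟨hτ, ⟨p, hsol⟩, hper, hns, hhyp, ⟨p, hsol⟩, isHomoclinicTo_self u, htr⟩,
    hτ, hwin, hwinE, hP, hG, hδ, hδ1, hco, ?_⟩
  have h0 : trainDwell ν (force S c) u τ δ ≤ 0 :=
    csInf_le (dwellSet_bddBelow ν (force S c) u τ δ) (zero_mem_dwellSet hsol hper)
  have h1 : 0 ≤ 1 + Pb := by linarith [fatness_nonneg hP]
  calc (1 + Pb) * trainDwell ν (force S c) u τ δ ≤ (1 + Pb) * 0 := mul_le_mul_of_nonneg_left h0 h1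
    _ = 0 := mul_zero _
    _ ≤ τ := hτ.le

/-- **Composition: the three stubs prove the crux `DenseLoudDesignerForces` (by name).**
Given `S₀`, the physics stub gives `S ⊇ S₀`, `εₓ > 0`, `Ē` and an open non-empty `U` with
`U ⊆ closure LOOP_j` at every level; take `E := 2Ē + 6`, `ε := εₓ/6 > 0`; then
`closure LOOP_j ⊆ closure LOUD_j(S,E,ε)` by `loopSet_subset_loudSet` (Stubs 1–2) and `closure_mono`. -/
theorem DenseLoudDesignerForces_of : DenseLoudDesignerForces := by
  intro S₀
  obtain ⟨S, hS, εx, Eb, hεx, U, hU, hUne, hdense⟩ := stub_denseLoudLoops S₀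
  refine ⟨S, hS, 2 * Eb + 6, εx / 6, by positivity, U, hU, hUne, fun j => ?_⟩
  exact (hdense j).trans (closure_mono (loopSet_subset_loudSet S Eb hεx j))

end Summit.AnomalousDissipation.AnomalousDissipation.Cruxes.DenseLoudDesignerForces.HomoclinicExcursionTrains

end
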